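import Literature.AlgebraicGeometry.Resolution.SecantColonAnnihilator
import Literature.AlgebraicGeometry.Resolution.ParameterColonAnnihilatorRegular
import Literature.AlgebraicGeometry.Resolution.ExtAnnihilatorSupport
import Literature.AlgebraicGeometry.Resolution.SecantElements
import HarnessLib

/-!
# Existence of colon-secant systems of parameters over regular local rings

Topic: `Literature/AlgebraicGeometry/Resolution` (the commutative-algebra input of Kawasaki's
Macaulayfication [Kawasaki2000, §2] / Česnavičius's CM-secant sequences [Cesnavicius2021, §3],
proved WITHOUT local cohomology or dualizing complexes, for modules over regular local rings —
e.g. the local rings of schemes of finite type over a field, seen as modules over the local rings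
of affine space).

Schenzel proves `𝔞₀(M)⋯𝔞_{d-1}(M) ⊆ 𝔯(M)` for the annihilators `𝔞ᵢ(M)` of the local cohomology
modules `Hⁱ_𝔪(M)` [Schenzel1982, Satz 2.4.2, Satz 2.4.5] and, when the ring has a dualizing
complex, `dim A/𝔞₀(M)⋯𝔞_{d-1}(M) < d` [Schenzel1982, Satz 2.2.4 (a), Kor. 2.4.3]. Here, with the
annihilators of `Ext^q_S(M, S)` over a regular local `S` instead:

* `prod_annihilator_EMod_le_secantColonAnnihilator` — over a regular local ring `S` of dimension
  `n`: `∏_{n-d < q ≤ max(n,2)} Ann_S Ext^q_S(M,S) ⊆ 𝔯(M)` (`Ext` computed by any free resolution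
  of finite type, `F.EMod q`) — the Ext form of Satz 2.4.2 (`ParameterColonAnnihilatorRegular`).
* `secantColonAnnihilator_not_le` — `𝔯(M) ⊄ 𝔭` for every prime `𝔭` with `dim S/𝔭 ≥ dim M`
  (the Ext form of Satz 2.2.4 (a) / Kor. 2.4.3, `ExtAnnihilatorSupport`).
* `exists_mem_secantColonAnnihilator_isSecantSequence` — hence `𝔯(M) ∩ 𝔪` contains a parameter
  element of `M` (`dim M ≥ 1`).
* `exists_isColonSecantSequence_length_eq` — **colon-secant systems of parameters exist** for
  every finite module over a regular local ring (cf. [Kawasaki2000, §2] and [Cesnavicius2021,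
  after Def. 3.1], there for CM-secant / `p`-standard sequences under a dualizing-complex
  hypothesis).

[cite: Schenzel1982, Satz 2.4.2, Satz 2.4.5, Kor. 2.4.3; Cesnavicius2021, Def. 3.1;
Kawasaki2000, Def. 2.6]
-/
noncomputable section

open IsLocalRing Ideal Module

universe u v

namespace Literature.AlgebraicGeometry.Resolution

variable {S : Type u} [CommRing S]

/-! ## Arithmetic -/

/-- In `WithBot ℕ∞`: `x + k = d` with `k d : ℕ` forces `x = d - k`. [folklore] -/
theorem WithBotENat.eq_natCast_sub_of_add_eq {x : WithBot ℕ∞} {k d : ℕ} (h : x + k = d) :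
    x = (d - k : ℕ) := by
  induction x using WithBot.recBotCoe with
  | bot =>
    rw [WithBot.bot_add] at h
    exact absurd h (WithBot.bot_ne_natCast d)
  | coe a =>
    induction a using ENat.recTopCoe with
    | top =>
      have h' : (⊤ : ℕ∞) + k = d := by exact_mod_cast h
      rw [top_add] at h'
      exact absurd h' (ENat.top_ne_coe d)
    | coe f =>
      have h' : f + k = d := by exact_mod_cast h
      have hf : f = d - k := by omega
      subst hf
      exact_mod_cast rfl

/-! ## The annihilator theorem (Ext form) -/

section Regular

variable [IsRegularLocalRing S]
variable {M : Type u} [AddCommGroup M] [Module S M] [Module.Finite S M]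

/-- **Schenzel's Satz 2.4.2, Ext form**: over a regular local ring of dimension `n`, for a finite
module `M ≠ 0` of dimension `d` and any free resolution of finite type `F` of `M`,
`∏_{n-d < q ≤ max(n,2)} Ann_S E^q ⊆ 𝔯(M)` (`E^q = F.EMod q ≅ Ext^q_S(M, S)`).
[cite: Schenzel1982, Satz 2.4.2; BrunsHerzog1998, Cor. 8.1.3 (b)] -/
theorem prod_annihilator_EMod_le_secantColonAnnihilator [Nontrivial M] (F : FreeResolution S M)
    {n d : ℕ} (hn : ringKrullDim S = n) (hd : Module.supportDim S M = d) :
    (∏ q ∈ Finset.Ioc (n - d) (max n 2), Module.annihilator S (F.EMod q)) ≤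
      secantColonAnnihilator S M :=
  fun _ hc _ hrs hmem _ hi _ hm =>
    smul_mem_of_getElem_smul_mem_of_mem_prod_annihilator F hn hd hrs hmem hi hc hm

/-- **`𝔯(M)` avoids the primes of large coheight** (Ext form of [Schenzel1982, Satz 2.2.4 (a),
Kor. 2.4.3], unconditionally over a regular local ring): if `dim S/𝔭 ≥ dim M` — e.g. `𝔭` a
minimal prime of `Supp M` with `dim S/𝔭 = dim M` — then `𝔯(M) ⊄ 𝔭`.
[cite: Schenzel1982, Kor. 2.4.3] -/
theorem secantColonAnnihilator_not_le (𝔭 : Ideal S) [𝔭.IsPrime]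
    (h𝔭 : Module.supportDim S M ≤ ringKrullDim (S ⧸ 𝔭)) : ¬ secantColonAnnihilator S M ≤ 𝔭 := by
  have h𝔭top : 𝔭 ≠ ⊤ := Ideal.IsPrime.ne_top inferInstance
  cases subsingleton_or_nontrivial M with
  | inl _ =>
    rw [secantColonAnnihilator_eq_top_of_subsingleton, top_le_iff]
    exact h𝔭top
  | inr _ =>
    obtain ⟨n, hn⟩ := exists_nat_cast_eq_ringKrullDim (R := S)
    obtain ⟨d, hd⟩ : ∃ d : ℕ, Module.supportDim S M = d := by
      obtain ⟨a, ha⟩ := WithBot.ne_bot_iff_exists.mp (Module.supportDim_ne_bot_of_nontrivial S M)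
      have ha' : a ≠ ⊤ := by
        rintro rfl
        exact supportDim_ne_top (R := S) (M := M) ha.symm
      obtain ⟨d, rfl⟩ := ENat.ne_top_iff_exists.mp ha'
      exact ⟨d, ha.symm⟩
    -- `ht 𝔭 ≤ n - d`
    have hht : 𝔭.height ≤ (n - d : ℕ) := by
      haveI : Nontrivial (S ⧸ 𝔭) := Ideal.Quotient.nontrivial_iff.mpr h𝔭top
      haveI : IsLocalRing (S ⧸ 𝔭) := .of_surjective' _ Ideal.Quotient.mk_surjective
      obtain ⟨e, he⟩ := exists_nat_cast_eq_ringKrullDim (R := S ⧸ 𝔭)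
      obtain ⟨q, hq⟩ := ENat.ne_top_iff_exists.mp (𝔭.height_ne_top h𝔭top)
      have hformula := height_add_ringKrullDim_quotient 𝔭
      rw [← hq, he, hn] at hformula
      have h1 : q + e = n := by
        have : ((q + e : ℕ) : WithBot ℕ∞) = n := by rw [← hformula]; rfl
        exact_mod_cast this
      rw [hd, he] at h𝔭
      have h2 : d ≤ e := by exact_mod_cast h𝔭
      rw [← hq]
      exact_mod_cast (show q ≤ n - d by omega)
    intro hle
    exact prod_annihilator_EMod_not_le_of_height_le (FreeResolution.ofNoetherian (R := S) M)
      (max n 2) 𝔭 hht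
      ((prod_annihilator_EMod_le_secantColonAnnihilator _ hn hd).trans hle)

/-- **Parameter elements in `𝔯(M)`**: for a finite module `M` of dimension `d ≥ 1` over a regular
local ring there is `x ∈ 𝔯(M) ∩ 𝔪` which is a secant (= parameter) element for `M`.
[cite: Schenzel1982, Kor. 2.4.3; Cesnavicius2021, §3.2] -/
theorem exists_mem_secantColonAnnihilator_isSecantSequence {d : ℕ}
    (hd : Module.supportDim S M = d) (hd1 : 1 ≤ d) :
    ∃ x ∈ secantColonAnnihilator S M, x ∈ maximalIdeal S ∧ IsSecantSequence M [x] := by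
  refine exists_mem_isSecantSequence_singleton hd hd1 _ fun p hp hpd => ?_
  haveI : p.IsPrime := hp.1.1
  exact secantColonAnnihilator_not_le p (by rw [hd, hpd])

end Regular

section Existence

variable [IsRegularLocalRing S]
variable {M : Type u} [AddCommGroup M] [Module S M] [Module.Finite S M]

/-- **Colon-secant systems of parameters exist** over a regular local ring: a finite module `M`
of dimension `d` has a colon-secant sequence of length `d` (a colon-secant system of parameters);
cf. [Cesnavicius2021, after Def. 3.1: "any CM-secant sequence can be extended to a CM-secant
sequence of parameters"] and [Kawasaki2000, §2] (existence of `p`-standard s.o.p. under a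
dualizing-complex hypothesis). Induction: extend `r₁,…,r_k` by a parameter element of
`𝔯(M/(r₁,…,r_k)M)` (`exists_mem_secantColonAnnihilator_isSecantSequence`).
[cite: Cesnavicius2021, Def. 3.1 (ii); Schenzel1982, Kor. 2.4.3] -/
theorem exists_isColonSecantSequence_length_eq {d : ℕ} (hd : Module.supportDim S M = d) :
    ∃ rs : List S, rs.length = d ∧ IsColonSecantSequence M rs := by
  cases subsingleton_or_nontrivial M with
  | inl _ =>
    rw [Module.supportDim_eq_bot_of_subsingleton] at hd
    exact absurd hd (by simp)
  | inr _ =>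
    have main : ∀ k, k ≤ d → ∃ rs : List S, rs.length = k ∧ IsColonSecantSequence M rs := by
      intro k
      induction k with
      | zero => exact fun _ => ⟨[], rfl, IsColonSecantSequence.nil⟩
      | succ k ih =>
        intro hk
        obtain ⟨rs, hlen, hrs⟩ := ih (Nat.le_of_succ_le hk)
        -- the quotient `N = M/(r₁,…,r_k)M` has dimension `d - k ≥ 1`
        set N := M ⧸ (ofList rs • ⊤ : Submodule S M) with hN
        have hdimN : Module.supportDim S N = (d - k : ℕ) := by
          have h0 := hrs.1.supportDim_quotient_add_length_eq hrs.2.1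
          rw [hd, hlen] at h0
          exact WithBotENat.eq_natCast_sub_of_add_eq h0
        obtain ⟨x, hx𝔯, hxm, hxsec⟩ :=
          exists_mem_secantColonAnnihilator_isSecantSequence (M := N) hdimN (by omega)
        refine ⟨rs ++ [x], by simp [hlen], ?_, ?_, ?_⟩
        · exact (isSecantSequence_append_iff rs [x]).mpr ⟨hrs.1, hxsec⟩
        · intro r hr
          rcases List.mem_append.mp hr with hr | hr
          · exact hrs.2.1 r hr
          · rw [List.mem_singleton.mp hr]; exact hxm
        · intro i hi
          rw [List.length_append, List.length_singleton, hlen] at hi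
          rcases Nat.lt_succ_iff_lt_or_eq.mp hi with hlt | heq
          · have hi' : i < rs.length := hlen ▸ hlt
            rw [List.getElem_append_left hi', List.take_append_of_le_length hi'.le]
            exact hrs.2.2 i hi'
          · subst heq
            rw [List.getElem_append_right (by rw [hlen]), List.take_append_of_le_length hlen.ge,
              List.take_of_length_le hlen.le]
            simpa [hlen] using hx𝔯
    exact main d le_rfl

end Existence

end Literature.AlgebraicGeometry.Resolution

end
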